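import Literature.Analysis.FluidPDE.AxisymNoSwirlVorticity
import Literature.Analysis.FluidPDE.ClassicalSolutionRescale
import Literature.Analysis.FluidPDE.KNSSTypeII
import Literature.Analysis.FluidPDE.SereginSverakBlowupSelection
import HarnessLib

/-!
# KNSS 2009, proof of Theorem 6.2, Steps 3–4: the two rescalings and their bounds (proved)

Analysis/FluidPDE support file (all results proved) for the decomposition of
`Literature.Analysis.FluidPDE.KNSS2009_regularity_typeI_rate` (`KNSSTypeII`; Koch–Nadirashvili–
Seregin–Šverák, Acta Math. 203 (2009) = arXiv:0709.3599, Theorem 6.2) along its printed proof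
(`KNSSTypeIRate`, module docstring). This file proves the bookkeeping of **Steps 3–4**
(arXiv pp. 12–13) for a field `u` on `(0, T) × ℝ³`:

* the **first rescaling** (vk) `v(y, s) = λ u(x₀ + λ y, T + λ² s)` about a point `x₀` of the
  axis (`v = λ • stPull (λ²) λ T x₀ u`): axisymmetry of the slices is preserved
  (`isAxisymmetric_smul_stPull_of_axis`); (assumption1) `√(T − t)‖u‖ ≤ C` becomes
  (assumptionvk) `√(−s)‖v‖ ≤ C` (`knssV_sqrt_neg_mul_norm_le`); a bound `|x'|‖u‖ ≤ 2M` up to time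
  `t₀` becomes (vkbound1) `|y'|‖v‖ ≤ 2M` up to `s₀ = −(T − t₀)λ⁻²`
  (`knssV_cylRadius_mul_norm_le`); and `‖v(e₁, s₀)‖ = λ‖u(x₀ + λe₁, t₀)‖`;
* the **second rescaling** (wk) `w(x, τ) = M⁻¹ v(e₁ + x/M, s₀ + τ/M²)`
  (`w = M⁻¹ • stPull (M⁻²) M⁻¹ s₀ e₁ v`): the slices are axisymmetric about the vertical axis
  through `c = −M e₁` (`knssW_axisymmetric_about`); (wkbound3) `√(−τ)‖w‖ ≤ C` for `τ < 0`
  (`knssW_sqrt_neg_mul_norm_le`); (wkbound) `‖w‖ ≤ 4` off the cylinder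
  `{cylRadius(x − c) ≤ M/2}` for `τ ≤ 0` (`knssW_norm_le_four_of_cylRadius`); (wkbound2)
  `‖w‖(M√(−τ) + cylRadius(x − c)) ≤ (C + 2)M` for `τ ≤ 0` (`knssW_norm_mul_le`); a bound
  `‖w‖ ≤ M⁻¹λ sup‖u‖`; and `‖w(0, 0)‖ = M⁻¹‖v(e₁, s₀)‖`;
* the time sets: the doubly rescaled time set is the interval
  `(−t₀M²λ⁻², (T − t₀)M²λ⁻²)` (`knss_preimage_preimage_Ioo_eq`).

The constants differ from print (`2`, `2CM/(M√(−τ) + Cρ)`) because Step 2 uses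
near-maximisers (`KNSSTypeIRateSelection`); see `KNSSTypeIRate`, "Constants". The fields are
classical solutions by `IsClassicalNSSolutionOn.nsRescale_translate_zero`
(`ClassicalSolutionRescale`); this file only does the pointwise bookkeeping. The linearity of
the rotations (`SereginSverak2009.rotZ_add_vec`, `SereginSverak2009.rotZ_smul_vec`,
`SereginSverakBlowupSelection`: the analogous axis-centred rescaling of Seregin–Šverák 2009, §4)
and the fixed points of the axis (`rotZ_eq_self_of_axis`, `AxisymNoSwirlVorticity`) are reused.

## References

* G. Koch, N. Nadirashvili, G. Seregin, V. Šverák, Acta Math. 203 (2009) 83–105 =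
  arXiv:0709.3599, proof of Theorem 6.2, pp. 12–13: (vk), (assumptionvk), (vkbound1),
  (vkbound2), (wk), (wkbound), (wkbound2), (wkbound3). [KochNadirashviliSereginSverak2009]
-/

noncomputable section

open Set Function Filter

namespace Literature.Analysis.FluidPDE

/-! ### Points of the axis under translation and dilation -/

/-- Translating by a point of the axis and dilating multiplies the cylindrical radius:
`cylRadius (x₀ + λ y) = |λ| cylRadius y`. [folklore] -/
theorem cylRadius_axis_add_smul {x₀ : EuclideanSpace ℝ (Fin 3)} (h0 : x₀ 0 = 0) (h1 : x₀ 1 = 0)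
    (lam : ℝ) (y : EuclideanSpace ℝ (Fin 3)) :
    cylRadius (x₀ + lam • y) = |lam| * cylRadius y := by
  rw [← cylRadius_smul]
  unfold cylRadius
  simp [h0, h1]

/-! ### Step 3: the first rescaling `v = λ • stPull (λ²) λ T x₀ u` -/

section FirstRescaling

variable {T lam : ℝ} {x₀ : EuclideanSpace ℝ (Fin 3)}
  {u : ℝ → EuclideanSpace ℝ (Fin 3) → EuclideanSpace ℝ (Fin 3)}

/-- Pointwise form of the first rescaling: `v(y, s) = λ u(x₀ + λ y, T + λ² s)` (KNSS (vk)). [cite: KochNadirashviliSereginSverak2009, proof of Thm 6.2, (vk) (arXiv p. 12)] -/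
theorem knssV_apply (s : ℝ) (y : EuclideanSpace ℝ (Fin 3)) :
    (lam • stPull (lam ^ 2) lam T x₀ u) s y = lam • u (T + lam ^ 2 * s) (x₀ + lam • y) := rfl

/-- **Axisymmetry is preserved by the first rescaling** about a point `x₀` of the axis: if
`u(t, ·)` is axisymmetric at `t = T + λ² s`, so is `v(·, s)` ("the functions `v⁽ᵏ⁾` are
axi-symmetric", KNSS p. 12–13). [cite: KochNadirashviliSereginSverak2009, proof of Thm 6.2 (arXiv pp. 12–13)] -/
theorem isAxisymmetric_smul_stPull_of_axis (h0 : x₀ 0 = 0) (h1 : x₀ 1 = 0) {s : ℝ}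
    (hu : IsAxisymmetric (u (T + lam ^ 2 * s))) :
    IsAxisymmetric ((lam • stPull (lam ^ 2) lam T x₀ u) s) := by
  intro θ y
  have e : x₀ + lam • rotZ θ y = rotZ θ (x₀ + lam • y) := by
    rw [SereginSverak2009.rotZ_add_vec, rotZ_eq_self_of_axis θ h0 h1, SereginSverak2009.rotZ_smul_vec]
  rw [knssV_apply, knssV_apply, e, hu θ, SereginSverak2009.rotZ_smul_vec]

/-- **(assumption1) is scale invariant: (assumptionvk).** If `√(T − t) ‖u(t, x)‖ ≤ C` on
`(0, T) × ℝ³` and `λ > 0`, then `√(−s) ‖v(y, s)‖ ≤ C` whenever `T + λ² s ∈ (0, T)`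
(KNSS p. 12: "Since (assumption1) is invariant under the Navier–Stokes scaling, the functions
`v⁽ᵏ⁾` satisfy `|v⁽ᵏ⁾| ≤ C/√(−s)`"). [cite: KochNadirashviliSereginSverak2009, proof of Thm 6.2, (assumptionvk) (arXiv p. 12)] -/
theorem knssV_sqrt_neg_mul_norm_le (hlam : 0 < lam) {C : ℝ}
    (hI : ∀ t ∈ Ioo 0 T, ∀ x, Real.sqrt (T - t) * ‖u t x‖ ≤ C) {s : ℝ}
    (hs : T + lam ^ 2 * s ∈ Ioo 0 T) (y : EuclideanSpace ℝ (Fin 3)) :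
    Real.sqrt (-s) * ‖(lam • stPull (lam ^ 2) lam T x₀ u) s y‖ ≤ C := by
  have key := hI _ hs (x₀ + lam • y)
  have hsq : Real.sqrt (T - (T + lam ^ 2 * s)) = lam * Real.sqrt (-s) := by
    rw [show T - (T + lam ^ 2 * s) = lam ^ 2 * (-s) by ring, Real.sqrt_mul (sq_nonneg _),
      Real.sqrt_sq hlam.le]
  rw [knssV_apply, norm_smul, Real.norm_of_nonneg hlam.le]
  calc Real.sqrt (-s) * (lam * ‖u (T + lam ^ 2 * s) (x₀ + lam • y)‖)
      = lam * Real.sqrt (-s) * ‖u (T + lam ^ 2 * s) (x₀ + lam • y)‖ := by ring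
    _ ≤ C := by rwa [hsq] at key

/-- **(vkbound1).** A bound `|x'| ‖u(t, x)‖ ≤ B` on `(0, t₀] × ℝ³` becomes `|y'| ‖v(y, s)‖ ≤ B`
whenever `T + λ² s ∈ (0, t₀]`, for `x₀` on the axis and `λ > 0` (KNSS p. 12: "from the
construction we have `|v⁽ᵏ⁾(y, s)| ≤ M_k/|y'|`, `s ≤ s_k`"). [cite: KochNadirashviliSereginSverak2009, proof of Thm 6.2, (vkbound1) (arXiv p. 12)] -/
theorem knssV_cylRadius_mul_norm_le (h0 : x₀ 0 = 0) (h1 : x₀ 1 = 0) (hlam : 0 < lam) {t₀ B : ℝ}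
    (hmax : ∀ τ ∈ Ioc 0 t₀, ∀ x, cylRadius x * ‖u τ x‖ ≤ B) {s : ℝ}
    (hs : T + lam ^ 2 * s ∈ Ioc 0 t₀) (y : EuclideanSpace ℝ (Fin 3)) :
    cylRadius y * ‖(lam • stPull (lam ^ 2) lam T x₀ u) s y‖ ≤ B := by
  have key := hmax _ hs (x₀ + lam • y)
  rw [cylRadius_axis_add_smul h0 h1, abs_of_pos hlam] at key
  rw [knssV_apply, norm_smul, Real.norm_of_nonneg hlam.le]
  calc cylRadius y * (lam * ‖u (T + lam ^ 2 * s) (x₀ + lam • y)‖)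
      = lam * cylRadius y * ‖u (T + lam ^ 2 * s) (x₀ + lam • y)‖ := by ring
    _ ≤ B := key

/-- A bound `‖u‖ ≤ B` at time `T + λ² s` gives `‖v(·, s)‖ ≤ λ B` (`λ ≥ 0`). [folklore] -/
theorem knssV_norm_le (hlam : 0 ≤ lam) {B : ℝ} {s : ℝ} (hB : ∀ x, ‖u (T + lam ^ 2 * s) x‖ ≤ B)
    (y : EuclideanSpace ℝ (Fin 3)) : ‖(lam • stPull (lam ^ 2) lam T x₀ u) s y‖ ≤ lam * B := by
  rw [knssV_apply, norm_smul, Real.norm_of_nonneg hlam]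
  exact mul_le_mul_of_nonneg_left (hB _) hlam

/-- The value of the first rescaling at `(e₁, s₀)`, `T + λ² s₀ = t₀`:
`‖v(e₁, s₀)‖ = λ ‖u(x₀ + λ e₁, t₀)‖` (`λ ≥ 0`; KNSS p. 12: "`|v⁽ᵏ⁾(·, s_k)| = M_k` on the unit
circle"). [cite: KochNadirashviliSereginSverak2009, proof of Thm 6.2 (arXiv p. 12)] -/
theorem knssV_norm_single (hlam : 0 ≤ lam) {s₀ t₀ : ℝ} (hs₀ : T + lam ^ 2 * s₀ = t₀) :
    ‖(lam • stPull (lam ^ 2) lam T x₀ u) s₀ (EuclideanSpace.single 0 1)‖ =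
      lam * ‖u t₀ (x₀ + lam • EuclideanSpace.single 0 1)‖ := by
  rw [knssV_apply, hs₀, norm_smul, Real.norm_of_nonneg hlam]

end FirstRescaling

/-! ### Step 4: the second rescaling `w = M⁻¹ • stPull (M⁻²) M⁻¹ s₀ e₁ v` -/

section SecondRescaling

variable {m s₀ : ℝ} {v : ℝ → EuclideanSpace ℝ (Fin 3) → EuclideanSpace ℝ (Fin 3)}

/-- Pointwise form of the second rescaling: `w(x, τ) = M⁻¹ v(e₁ + M⁻¹ x, s₀ + M⁻² τ)`
(KNSS (wk)). [cite: KochNadirashviliSereginSverak2009, proof of Thm 6.2, (wk) (arXiv p. 13)] -/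
theorem knssW_apply (τ : ℝ) (x : EuclideanSpace ℝ (Fin 3)) :
    (m⁻¹ • stPull (m⁻¹ ^ 2) m⁻¹ s₀ (EuclideanSpace.single 0 1) v) τ x =
      m⁻¹ • v (s₀ + m⁻¹ ^ 2 * τ) (EuclideanSpace.single 0 1 + m⁻¹ • x) := rfl

/-- The point `x − c`, `c = −M e₁`, is `M` times the argument `e₁ + M⁻¹ x` of `v` in (wk). [folklore] -/
theorem knss_sub_single_neg_eq_smul (hm : m ≠ 0) (x : EuclideanSpace ℝ (Fin 3)) :
    x - EuclideanSpace.single 0 (-m) = m • (EuclideanSpace.single 0 1 + m⁻¹ • x) := by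
  ext i
  fin_cases i <;> simp [hm]
  ring

/-- The distance to the axis through `c = −M e₁` is `M cylRadius (e₁ + M⁻¹ x)` (`M > 0`). [folklore] -/
theorem knss_cylRadius_sub_single_neg (hm : 0 < m) (x : EuclideanSpace ℝ (Fin 3)) :
    cylRadius (x - EuclideanSpace.single 0 (-m)) =
      m * cylRadius (EuclideanSpace.single 0 1 + m⁻¹ • x) := by
  rw [knss_sub_single_neg_eq_smul hm.ne', cylRadius_smul, abs_of_pos hm]

/-- The rotation about the axis through `c = −M e₁`, seen in the variable `y = e₁ + M⁻¹ x` of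
(wk), is the rotation about the coordinate axis:
`e₁ + M⁻¹ (c + R_θ(x − c)) = R_θ (e₁ + M⁻¹ x)`. [folklore] -/
theorem knss_single_add_smul_rot_about (hm : m ≠ 0) (θ : ℝ) (x : EuclideanSpace ℝ (Fin 3)) :
    EuclideanSpace.single 0 1 + m⁻¹ • (EuclideanSpace.single 0 (-m) +
      rotZ θ (x - EuclideanSpace.single 0 (-m))) =
      rotZ θ (EuclideanSpace.single 0 1 + m⁻¹ • x) := by
  rw [knss_sub_single_neg_eq_smul hm, SereginSverak2009.rotZ_smul_vec, smul_add, smul_smul,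
    inv_mul_cancel₀ hm, one_smul]
  ext i
  fin_cases i <;> simp [hm]

/-- **The slices of `w` are axisymmetric about the vertical axis through `c = −M e₁`** if the
slice of `v` at `s = s₀ + M⁻² τ` is axisymmetric (KNSS p. 13: the `v⁽ᵏ⁾` are axisymmetric, and
(wk) moves the axis to distance `M_k` from the origin). [cite: KochNadirashviliSereginSverak2009, proof of Thm 6.2 (arXiv p. 13)] -/
theorem knssW_axisymmetric_about (hm : m ≠ 0) {τ : ℝ} (hv : IsAxisymmetric (v (s₀ + m⁻¹ ^ 2 * τ)))
    (θ : ℝ) (x : EuclideanSpace ℝ (Fin 3)) :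
    (m⁻¹ • stPull (m⁻¹ ^ 2) m⁻¹ s₀ (EuclideanSpace.single 0 1) v) τ
        (EuclideanSpace.single 0 (-m) + rotZ θ (x - EuclideanSpace.single 0 (-m))) =
      rotZ θ ((m⁻¹ • stPull (m⁻¹ ^ 2) m⁻¹ s₀ (EuclideanSpace.single 0 1) v) τ x) := by
  rw [knssW_apply, knssW_apply, knss_single_add_smul_rot_about hm, hv θ,
    SereginSverak2009.rotZ_smul_vec]

/-- `√(−τ) M⁻¹ ≤ √(−s)` for `s = s₀ + M⁻² τ`, `s₀ ≤ 0`, `M > 0` (the time bookkeeping behind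
(wkbound2)–(wkbound3): `−s ≥ −M⁻²τ`). [folklore] -/
theorem knss_sqrt_neg_mul_inv_le (hm : 0 < m) (hs₀ : s₀ ≤ 0) (τ : ℝ) :
    Real.sqrt (-τ) * m⁻¹ ≤ Real.sqrt (-(s₀ + m⁻¹ ^ 2 * τ)) := by
  have hinv : 0 ≤ m⁻¹ := inv_nonneg.2 hm.le
  have e : Real.sqrt (-τ) * m⁻¹ = Real.sqrt ((-τ) * m⁻¹ ^ 2) := by
    rw [Real.sqrt_mul' _ (sq_nonneg _), Real.sqrt_sq hinv]
  rw [e]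
  refine Real.sqrt_le_sqrt ?_
  have : 0 ≤ -s₀ * 1 := by linarith
  nlinarith [sq_nonneg m⁻¹]

/-- **(wkbound3).** If `√(−s) ‖v(y, s)‖ ≤ C` at `s = s₀ + M⁻² τ` (all `y`), `s₀ ≤ 0`, `M > 0`,
then `√(−τ) ‖w(x, τ)‖ ≤ C` (KNSS p. 13: "(assumptionvk) implies `|w⁽ᵏ⁾(x, τ)| ≤ C/√(−τ)`"). [cite: KochNadirashviliSereginSverak2009, proof of Thm 6.2, (wkbound3) (arXiv p. 13)] -/
theorem knssW_sqrt_neg_mul_norm_le (hm : 0 < m) (hs₀ : s₀ ≤ 0) {C τ : ℝ}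
    (hv : ∀ y, Real.sqrt (-(s₀ + m⁻¹ ^ 2 * τ)) * ‖v (s₀ + m⁻¹ ^ 2 * τ) y‖ ≤ C)
    (x : EuclideanSpace ℝ (Fin 3)) :
    Real.sqrt (-τ) * ‖(m⁻¹ • stPull (m⁻¹ ^ 2) m⁻¹ s₀ (EuclideanSpace.single 0 1) v) τ x‖ ≤ C := by
  rw [knssW_apply, norm_smul, Real.norm_of_nonneg (inv_nonneg.2 hm.le), ← mul_assoc]
  exact (mul_le_mul_of_nonneg_right (knss_sqrt_neg_mul_inv_le hm hs₀ τ) (norm_nonneg _)).trans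
    (hv _)

/-- **(wkbound).** If `|y'| ‖v(y, s)‖ ≤ 2M` at `s = s₀ + M⁻² τ` (all `y`), then `‖w(x, τ)‖ ≤ 4`
off the cylinder `{cylRadius (x − c) ≤ M/2}`, `c = −M e₁` (KNSS p. 13: `|w⁽ᵏ⁾| ≤ 2` outside
`𝒞_k`, with the near-maximiser constant `2M` in place of `M`). [cite: KochNadirashviliSereginSverak2009, proof of Thm 6.2, (wkbound) (arXiv p. 13)] -/
theorem knssW_norm_le_four_of_cylRadius (hm : 0 < m) {τ : ℝ}
    (hv : ∀ y, cylRadius y * ‖v (s₀ + m⁻¹ ^ 2 * τ) y‖ ≤ 2 * m) {x : EuclideanSpace ℝ (Fin 3)}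
    (hx : m / 2 < cylRadius (x - EuclideanSpace.single 0 (-m))) :
    ‖(m⁻¹ • stPull (m⁻¹ ^ 2) m⁻¹ s₀ (EuclideanSpace.single 0 1) v) τ x‖ ≤ 4 := by
  rw [knss_cylRadius_sub_single_neg hm] at hx
  set y : EuclideanSpace ℝ (Fin 3) := EuclideanSpace.single 0 1 + m⁻¹ • x with hy
  have hr : 1 / 2 < cylRadius y := by
    by_contra h
    have : m * cylRadius y ≤ m * (1 / 2) := mul_le_mul_of_nonneg_left (not_lt.1 h) hm.le
    linarith
  have key := hv y
  rw [knssW_apply, norm_smul, Real.norm_of_nonneg (inv_nonneg.2 hm.le)]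
  rw [← hy]
  have h1 : cylRadius y * (m⁻¹ * ‖v (s₀ + m⁻¹ ^ 2 * τ) y‖) ≤ 2 := by
    calc cylRadius y * (m⁻¹ * ‖v (s₀ + m⁻¹ ^ 2 * τ) y‖)
        = m⁻¹ * (cylRadius y * ‖v (s₀ + m⁻¹ ^ 2 * τ) y‖) := by ring
      _ ≤ m⁻¹ * (2 * m) := mul_le_mul_of_nonneg_left key (inv_nonneg.2 hm.le)
      _ = 2 := by field_simp
  by_contra hlt
  have hpos : 0 < m⁻¹ * ‖v (s₀ + m⁻¹ ^ 2 * τ) y‖ := lt_trans (by norm_num) (not_le.1 hlt)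
  have h3 : 1 / 2 * (m⁻¹ * ‖v (s₀ + m⁻¹ ^ 2 * τ) y‖) <
      cylRadius y * (m⁻¹ * ‖v (s₀ + m⁻¹ ^ 2 * τ) y‖) := mul_lt_mul_of_pos_right hr hpos
  linarith [not_le.1 hlt]

/-- **(wkbound2).** If at `s = s₀ + M⁻² τ` both `√(−s) ‖v(y, s)‖ ≤ C` and `|y'| ‖v(y, s)‖ ≤ 2M`
hold for all `y`, with `s₀ ≤ 0 `and `M > 0`, then
`‖w(x, τ)‖ (M √(−τ) + cylRadius (x − c)) ≤ (C + 2) M`, `c = −M e₁` (KNSS p. 13, from (vkbound2)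
`|v⁽ᵏ⁾| ≤ 2CM_k/(M_k√(−s) + C|y'|)`, the elementary `min(1/a, 1/b) ≤ 2/(a + b)`; here in the
additive form, with the near-maximiser constants). [cite: KochNadirashviliSereginSverak2009, proof of Thm 6.2, (vkbound2) and (wkbound2) (arXiv pp. 12–13)] -/
theorem knssW_norm_mul_le (hm : 0 < m) (hs₀ : s₀ ≤ 0) {C τ : ℝ}
    (hvI : ∀ y, Real.sqrt (-(s₀ + m⁻¹ ^ 2 * τ)) * ‖v (s₀ + m⁻¹ ^ 2 * τ) y‖ ≤ C)
    (hvr : ∀ y, cylRadius y * ‖v (s₀ + m⁻¹ ^ 2 * τ) y‖ ≤ 2 * m) (x : EuclideanSpace ℝ (Fin 3)) :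
    ‖(m⁻¹ • stPull (m⁻¹ ^ 2) m⁻¹ s₀ (EuclideanSpace.single 0 1) v) τ x‖ *
        (m * Real.sqrt (-τ) + cylRadius (x - EuclideanSpace.single 0 (-m))) ≤ (C + 2) * m := by
  rw [knss_cylRadius_sub_single_neg hm, knssW_apply, norm_smul,
    Real.norm_of_nonneg (inv_nonneg.2 hm.le)]
  set y : EuclideanSpace ℝ (Fin 3) := EuclideanSpace.single 0 1 + m⁻¹ • x with hy
  set N := ‖v (s₀ + m⁻¹ ^ 2 * τ) y‖ with hN
  have hN0 : 0 ≤ N := norm_nonneg _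
  -- the Type I part: `√(-τ) N ≤ C M`
  have h1 : Real.sqrt (-τ) * m⁻¹ * N ≤ C :=
    (mul_le_mul_of_nonneg_right (knss_sqrt_neg_mul_inv_le hm hs₀ τ) hN0).trans (hvI y)
  have h1' : Real.sqrt (-τ) * N ≤ C * m := by
    have := mul_le_mul_of_nonneg_right h1 hm.le
    calc Real.sqrt (-τ) * N = Real.sqrt (-τ) * m⁻¹ * N * m := by field_simp
      _ ≤ C * m := this
  -- the radial part: `cylRadius y * N ≤ 2 M`
  have h2 : cylRadius y * N ≤ 2 * m := hvr y
  calc m⁻¹ * N * (m * Real.sqrt (-τ) + m * cylRadius y)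
      = Real.sqrt (-τ) * N + cylRadius y * N := by field_simp
    _ ≤ C * m + 2 * m := add_le_add h1' h2
    _ = (C + 2) * m := by ring

/-- A bound `‖v(·, s)‖ ≤ B` at `s = s₀ + M⁻² τ` gives `‖w(·, τ)‖ ≤ M⁻¹ B` (`M > 0`). [folklore] -/
theorem knssW_norm_le (hm : 0 < m) {B τ : ℝ} (hv : ∀ y, ‖v (s₀ + m⁻¹ ^ 2 * τ) y‖ ≤ B)
    (x : EuclideanSpace ℝ (Fin 3)) :
    ‖(m⁻¹ • stPull (m⁻¹ ^ 2) m⁻¹ s₀ (EuclideanSpace.single 0 1) v) τ x‖ ≤ m⁻¹ * B := by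
  rw [knssW_apply, norm_smul, Real.norm_of_nonneg (inv_nonneg.2 hm.le)]
  exact mul_le_mul_of_nonneg_left (hv _) (inv_nonneg.2 hm.le)

/-- **The vertex value**: `‖w(0, 0)‖ = M⁻¹ ‖v(e₁, s₀)‖` (`M > 0`; KNSS p. 13:
`|w⁽ᵏ⁾(0, 0)| = 1`). [cite: KochNadirashviliSereginSverak2009, proof of Thm 6.2 (arXiv p. 13)] -/
theorem knssW_norm_zero_zero (hm : 0 < m) :
    ‖(m⁻¹ • stPull (m⁻¹ ^ 2) m⁻¹ s₀ (EuclideanSpace.single 0 1) v) 0 0‖ =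
      m⁻¹ * ‖v s₀ (EuclideanSpace.single 0 1)‖ := by
  rw [knssW_apply, norm_smul, Real.norm_of_nonneg (inv_nonneg.2 hm.le)]
  simp

end SecondRescaling

/-! ### The doubly rescaled time set -/

section TimeSet

variable {T lam m t₀ : ℝ}

/-- The composite of the two affine time changes: `T + λ²((t₀ − T)λ⁻² + M⁻²τ) = t₀ + (λ²/M²)τ`. [folklore] -/
theorem knss_time_affine_eq (hlam : lam ≠ 0) (hm : m ≠ 0) (τ : ℝ) :
    T + lam ^ 2 * ((t₀ - T) / lam ^ 2 + m⁻¹ ^ 2 * τ) = t₀ + lam ^ 2 / m ^ 2 * τ := by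
  field_simp
  ring

/-- `s₀ = (t₀ − T)λ⁻²` satisfies `T + λ² s₀ = t₀`. [folklore] -/
theorem knss_add_sq_mul_s₀ (hlam : lam ≠ 0) : T + lam ^ 2 * ((t₀ - T) / lam ^ 2) = t₀ := by
  field_simp
  ring

/-- `s₀ = (t₀ − T)λ⁻² ≤ 0` for `t₀ ≤ T`. [folklore] -/
theorem knss_s₀_nonpos (ht₀ : t₀ ≤ T) : (t₀ - T) / lam ^ 2 ≤ 0 :=
  div_nonpos_of_nonpos_of_nonneg (by linarith) (sq_nonneg _)

/-- **The time set of `w`.** Composing the two affine time changes, the preimage of `(0, T)`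
under `s ↦ T + λ² s` and then under `τ ↦ s₀ + M⁻² τ`, with `s₀ = (t₀ − T)λ⁻²`, is the
interval `(A, B) = (−t₀ M² λ⁻², (T − t₀) M² λ⁻²)` (KNSS p. 13: `w⁽ᵏ⁾` lives on `(A_k, 0]` with
`A_k = M_k²(−Tλ_k⁻² − s_k)`, indeed up to `B_k = −M_k² s_k > 0`). [cite: KochNadirashviliSereginSverak2009, proof of Thm 6.2 (arXiv p. 13)] -/
theorem knss_preimage_preimage_Ioo_eq (hlam : 0 < lam) (hm : 0 < m) :
    (fun r => (t₀ - T) / lam ^ 2 + m⁻¹ ^ 2 * r) ⁻¹' ((fun r => T + lam ^ 2 * r) ⁻¹' Ioo 0 T) =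
      Ioo (-(t₀ * m ^ 2 / lam ^ 2)) ((T - t₀) * m ^ 2 / lam ^ 2) := by
  have hl : lam ≠ 0 := hlam.ne'
  have hm0 : m ≠ 0 := hm.ne'
  have hκ : 0 < lam ^ 2 / m ^ 2 := by positivity
  have step :
      (fun r => (t₀ - T) / lam ^ 2 + m⁻¹ ^ 2 * r) ⁻¹' ((fun r => T + lam ^ 2 * r) ⁻¹' Ioo 0 T) =
        (fun τ => lam ^ 2 / m ^ 2 * τ) ⁻¹' ((fun x => t₀ + x) ⁻¹' Ioo 0 T) := by
    ext τ
    simp only [mem_preimage, knss_time_affine_eq hl hm0]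
  rw [step, Set.preimage_const_add_Ioo, Set.preimage_const_mul_Ioo₀ _ _ hκ]
  rw [zero_sub]
  congr 1
  · field_simp
  · field_simp

/-- For `τ ∈ (A, B)` the corresponding time `T + λ²(s₀ + M⁻²τ)` of `u` lies in `(0, T)`. [folklore] -/
theorem knss_mem_Ioo_time (hlam : 0 < lam) (hm : 0 < m) {τ : ℝ}
    (hτ : τ ∈ Ioo (-(t₀ * m ^ 2 / lam ^ 2)) ((T - t₀) * m ^ 2 / lam ^ 2)) :
    T + lam ^ 2 * ((t₀ - T) / lam ^ 2 + m⁻¹ ^ 2 * τ) ∈ Ioo 0 T := by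
  have h : τ ∈ (fun r => (t₀ - T) / lam ^ 2 + m⁻¹ ^ 2 * r) ⁻¹'
      ((fun r => T + lam ^ 2 * r) ⁻¹' Ioo 0 T) := by
    rw [knss_preimage_preimage_Ioo_eq hlam hm]
    exact hτ
  exact h

/-- For `τ ∈ (A, 0]` the corresponding time of `u` lies in `(0, t₀]`. [folklore] -/
theorem knss_mem_Ioc_time (hlam : 0 < lam) (hm : 0 < m) {τ : ℝ}
    (hτ : τ ∈ Ioc (-(t₀ * m ^ 2 / lam ^ 2)) 0) :
    T + lam ^ 2 * ((t₀ - T) / lam ^ 2 + m⁻¹ ^ 2 * τ) ∈ Ioc 0 t₀ := by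
  have hl : lam ≠ 0 := hlam.ne'
  have hm0 : m ≠ 0 := hm.ne'
  have hκ : 0 < lam ^ 2 / m ^ 2 := by positivity
  rw [knss_time_affine_eq hl hm0]
  constructor
  · have h1 : lam ^ 2 / m ^ 2 * (-(t₀ * m ^ 2 / lam ^ 2)) = -t₀ := by field_simp
    have := mul_lt_mul_of_pos_left hτ.1 hκ
    rw [h1] at this
    linarith
  · have := mul_le_mul_of_nonneg_left hτ.2 hκ.le
    rw [mul_zero] at this
    linarith

end TimeSet

end Literature.Analysis.FluidPDE

end
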